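import Mathlib
import Literature.NumberTheory.LFunctions.Zhang2022.TypedSection12A
import Literature.NumberTheory.LFunctions.Zhang2022.Section11SmoothedStep
import HarnessLib

/-!
# Zhang (2022) §12 p. 67: the SHARP Gaussian profile of the (12.8) dual-window coefficients

Topic `Literature/NumberTheory/LFunctions/Zhang2022` (Landau–Siegel audit tree; verdict-neutral).
Y. Zhang, *Discrete mean estimates and the Landau–Siegel zero*, arXiv:2211.02515v1 (2022)
[Zhang2022LandauSiegel] — **an unrefereed manuscript under adjudication; nothing here asserts or
denies its Theorems 1–2.** Helper under the leaf hXi = `Typed.Sec12A.Xi15Hbar16` (cell GAP row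
G-d42-3 (ii)): the input data for the unprinted estimate "`S_j(𝐜̄,𝐜) = o(α𝔞)`" (the hypothesis `hS` of
the tree's `Typed.Sec12A.eq128_of_sj_small`), where `𝐜` is the coefficient sequence of the dual
difference `H̃₁₅`-dual-side `−` `H̄₁₆` (§12 p. 67, tex L3427–L3447):
`𝐜(n) = χ(n)(n/P″₁)^{β₆}·{(I(n)/0.504)𝟙[P″₁η₋ < n < P″₂η₊] − (log(n/P″₁)/log P₁)𝟙[P″₁ < n < P″₂]}`,
`I(n) = ∫_{0.496}^{0.5}{g(P^{0.5}Dt₀/n) − g(P^zDt₀/n)}dz` (`Typed.Sec12A.dualInt`), `P″₁ = P^{0.496}Dt₀`,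
`P″₂ = P^{0.5}Dt₀`. Twin of `Section12Eq126ProfileSharp` (the (12.6) sequence).

With `Y = n/(Dt₀)`, `u = log Y/𝓛⁹` (so `P^zDt₀/n = P^z/Y`, `P″₁ < n < P″₂ ⇔ 0.496 < u < 0.5`) the sharp
side is `(u − 0.496)𝟙[0.496 < u < 0.5] = 0.004·𝟙[u < 0.5] − (0.5 − clamp(u;0.496,0.5))` and the smooth
side `I(n) = 0.004·g(P^{0.5}/Y) − ∫_{0.496}^{0.5} g(P^z/Y)dz`: a JUMP of height `0.004` at `P″₂`
carried by the smoothed step `g(P^{0.5}/Y)` (error `≤ ½e^{−𝓛³⁰(log Y − 𝓛⁹/2)²}`, (4.2)/(4.3)) and a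
KINK term (error `≤ ½√π·𝓛⁻²⁴` everywhere, `≤ 0.002e^{−𝓛³⁰w²}` at log-distance `≥ w` from `P″₁`, `P″₂`,
tree `SmoothedStep.integral_step_*`). Results (`D ≥ 2`):

* `abs_dualInt_sub_sharp_le` — `|I(n) − 0.504·(log(n/P″₁)/log P₁)𝟙[P″₁<n<P″₂]| ≤ 𝓛⁻²⁴ +
  0.002·e^{−𝓛³⁰(log(n/(Dt₀)) − 𝓛⁹/2)²}` (`n ≥ 1`; exact form `…_le'`), far form `…_le_far`
  (`≤ 0.004e^{−𝓛³⁰w²}`);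
* `c128_eq` — the literal second `S_j`-argument of `eq128_of_sj_small` equals
  `χ(n)(n/P″₁)^{β₆}·(that difference)/0.504` on `P″₁η₋ < n < P″₂η₊` and `0` off it; `norm_c128_le`;
* `norm_c128_le_profile` (`‖𝐜 n‖ ≤ 2𝓛⁻²⁴ + 0.004e^{−𝓛³⁰(log(n/(Dt₀)) − 𝓛⁹/2)²}`), `norm_c128_le_far`
  (`≤ 0.008e^{−𝓛³⁰w²}`), `norm_c128_le_of_far_half`, `norm_c128_le_global` (`≤ 0.005`, `𝓛 ≥ 2`),
  `c128_eq_zero_of_not_window`; the first `S_j`-argument is `conj ∘ 𝐜`, same norms (`norm_conj_c128`).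

So `𝐜` is `O(1)` only within log-distance `≈ 𝓛⁻¹⁵` of `P″₂` (not on the printed edge window of
log-width `2𝓛⁻¹⁰`), `O(𝓛⁻²⁴)` near `P″₁`, and `≤ 0.008e^{−𝓛²}` at log-distance `𝓛⁻¹⁴` from both.
0 new definitions, 0 facts; standard axioms.

## References

* Y. Zhang, arXiv:2211.02515v1 (2022), §12 p. 67 (tex L3427–L3447), (12.8); §4 (4.1)–(4.3);
  §11 p. 63. [cite: Zhang2022LandauSiegel, §12 p. 67]
-/

noncomputable section

open Complex Real ComplexConjugate MeasureTheory
open Literature.NumberTheory.LFunctions.Zhang2022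
open Literature.NumberTheory.LFunctions.Zhang2022.Skeleton

namespace Literature.NumberTheory.LFunctions.Zhang2022.Typed.Sec12A

/-! ### Elementary rewrites -/

/-- `P^z = e^{𝓛⁹z}` ((2.6)). [cite: Zhang2022LandauSiegel, §2 (2.6)] -/
private theorem bigP_rpow_eq_exp' (D : ℕ) (z : ℝ) : bigP D ^ z = Real.exp (ell D ^ 9 * z) := by
  rw [bigP, ← Real.exp_mul]

/-- `Dt₀ > 0` for `D ≥ 2`. [folklore] -/
private theorem D_mul_t0_pos' {D : ℕ} (hD : 2 ≤ D) : 0 < (D : ℝ) * t0 D := by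
  have hD' : (0 : ℝ) < D := by exact_mod_cast lt_of_lt_of_le two_pos hD
  exact mul_pos hD' (pow_pos (ell_pos hD) 519)

/-- `g(P^zDt₀/n) = g_Λ(e^{Kz}/Y)`, `Y = n/(Dt₀)`, `Λ = 𝓛³⁰`, `K = 𝓛⁹`.
[cite: Zhang2022LandauSiegel, §12 p. 67] -/
private theorem gW_dual_arg {D : ℕ} (hD : 2 ≤ D) (n : ℕ) (z : ℝ) :
    gW D (bigP D ^ z * D * t0 D / n) =
      GaussWeight.gWeight (ell D ^ 30) (Real.exp (ell D ^ 9 * z) / ((n : ℝ) / ((D : ℝ) * t0 D))) := by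
  have hDt := (D_mul_t0_pos' hD).ne'
  rw [gW, bigP_rpow_eq_exp', div_div_eq_mul_div, mul_assoc]

/-- `P″₁ < n ⇔ 0.496 < log(n/(Dt₀))/𝓛⁹` (`n ≥ 1`, `D ≥ 2`). [cite: Zhang2022LandauSiegel, §12 p. 67] -/
private theorem P1pp_lt_iff {D : ℕ} (hD : 2 ≤ D) {n : ℕ} (hn : 1 ≤ n) :
    P1pp D < (n : ℝ) ↔ 0.496 < Real.log ((n : ℝ) / ((D : ℝ) * t0 D)) / ell D ^ 9 := by
  have hK : 0 < ell D ^ 9 := pow_pos (ell_pos hD) 9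
  have hDt : 0 < (D : ℝ) * t0 D := D_mul_t0_pos' hD
  have hn0 : (0 : ℝ) < n := by exact_mod_cast hn
  have hy : 0 < (n : ℝ) / ((D : ℝ) * t0 D) := div_pos hn0 hDt
  rw [P1pp, bigP_rpow_eq_exp', mul_assoc, ← lt_div_iff₀ hDt, ← Real.lt_log_iff_exp_lt hy,
    lt_div_iff₀ hK]
  constructor <;> intro h <;> linarith

/-- `n < P″₂ ⇔ log(n/(Dt₀))/𝓛⁹ < 0.5` (`n ≥ 1`, `D ≥ 2`). [cite: Zhang2022LandauSiegel, §12 p. 67] -/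
private theorem lt_P2pp_iff {D : ℕ} (hD : 2 ≤ D) {n : ℕ} (hn : 1 ≤ n) :
    (n : ℝ) < P2pp D ↔ Real.log ((n : ℝ) / ((D : ℝ) * t0 D)) / ell D ^ 9 < 0.5 := by
  have hK : 0 < ell D ^ 9 := pow_pos (ell_pos hD) 9
  have hDt : 0 < (D : ℝ) * t0 D := D_mul_t0_pos' hD
  have hn0 : (0 : ℝ) < n := by exact_mod_cast hn
  have hy : 0 < (n : ℝ) / ((D : ℝ) * t0 D) := div_pos hn0 hDt
  rw [P2pp, bigP_rpow_eq_exp', mul_assoc, ← div_lt_iff₀ hDt, ← Real.log_lt_iff_lt_exp hy,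
    div_lt_iff₀ hK]
  constructor <;> intro h <;> linarith

/-- `log(n/P″₁)/log P₁ = (u − 0.496)/0.504`, `u = log(n/(Dt₀))/𝓛⁹` (`log P₁ = 0.504𝓛⁹`).
[cite: Zhang2022LandauSiegel, §12 p. 67] -/
private theorem log_div_P1pp_div {D : ℕ} (hD : 2 ≤ D) {n : ℕ} (hn : 1 ≤ n) :
    Real.log ((n : ℝ) / P1pp D) / Real.log (Skeleton.P1 D) =
      (Real.log ((n : ℝ) / ((D : ℝ) * t0 D)) / ell D ^ 9 - 0.496) / 0.504 := by
  have hK : 0 < ell D ^ 9 := pow_pos (ell_pos hD) 9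
  have hDt : 0 < (D : ℝ) * t0 D := D_mul_t0_pos' hD
  have hn0 : (0 : ℝ) < n := by exact_mod_cast hn
  have hP : 0 < bigP D ^ (0.496 : ℝ) := Real.rpow_pos_of_pos (Real.exp_pos _) _
  have e1 : Real.log ((n : ℝ) / P1pp D) =
      Real.log ((n : ℝ) / ((D : ℝ) * t0 D)) - ell D ^ 9 * 0.496 := by
    rw [P1pp, mul_assoc, Real.log_div hn0.ne' (mul_pos hP hDt).ne', Real.log_mul hP.ne' hDt.ne',
      Real.log_div hn0.ne' hDt.ne', bigP_rpow_eq_exp', Real.log_exp]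
    ring
  have hK' : ell D ^ 9 ≠ 0 := hK.ne'
  rw [e1, log_P1, mul_comm (0.504 : ℝ) (ell D ^ 9), ← div_div, sub_div,
    mul_div_cancel_left₀ _ hK']

/-! ### The real-variable core: kink term + jump term on `[0.496, 0.5]` (jump at the upper end) -/

/-- **Core estimate (dual)**: for `𝓛 > 0`, `Y > 0`, `u = log Y/𝓛⁹`, `I = ∫_{0.496}^{0.5} g_Λ(e^{Kz}/Y)dz`,
`g₀ = g_Λ(e^{K/2}/Y)`:
`|(0.004g₀ − I) − (0.004·𝟙[u<0.5] − (0.5 − clamp(u;0.496,0.5)))| ≤ ½√(π/(𝓛³⁰(𝓛⁹)²)) + 0.004·½e^{−𝓛³⁰(𝓛⁹·0.5 − log Y)²}`.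
[cite: Zhang2022LandauSiegel, §12 p. 67, §11 p. 63, §4 (4.2)–(4.3)] -/
private theorem core_profile_dual {D : ℕ} (hℓ : 0 < ell D) {y : ℝ} (hy : 0 < y) :
    |(0.004 * GaussWeight.gWeight (ell D ^ 30) (Real.exp (ell D ^ 9 * 0.5) / y) -
          ∫ z in (0.496 : ℝ)..0.5, GaussWeight.gWeight (ell D ^ 30) (Real.exp (ell D ^ 9 * z) / y)) -
        (0.004 * (if Real.log y / ell D ^ 9 < 0.5 then (1 : ℝ) else 0) -
          (0.5 - max 0.496 (min (Real.log y / ell D ^ 9) 0.5)))| ≤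
      (1 / 2) * Real.sqrt (π / (ell D ^ 30 * (ell D ^ 9) ^ 2)) +
        0.004 * ((1 / 2) * Real.exp (-(ell D ^ 30) * (ell D ^ 9 * 0.5 - Real.log y) ^ 2)) := by
  have hΛ : 0 < ell D ^ 30 := pow_pos hℓ 30
  have hK : 0 < ell D ^ 9 := pow_pos hℓ 9
  have hI := SmoothedStep.integral_step_crude hΛ hK hy (a := 0.496) (b := 0.5) (by norm_num)
  set I : ℝ := ∫ z in (0.496 : ℝ)..0.5,
    GaussWeight.gWeight (ell D ^ 30) (Real.exp (ell D ^ 9 * z) / y) with hIdef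
  set g₀ : ℝ := GaussWeight.gWeight (ell D ^ 30) (Real.exp (ell D ^ 9 * 0.5) / y) with hg₀
  set c : ℝ := (1 / 2) * Real.sqrt (π / (ell D ^ 30 * (ell D ^ 9) ^ 2)) with hc
  set γ : ℝ := (1 / 2) * Real.exp (-(ell D ^ 30) * (ell D ^ 9 * 0.5 - Real.log y) ^ 2) with hγ
  set T : ℝ := 0.5 - max 0.496 (min (Real.log y / ell D ^ 9) 0.5) with hT
  by_cases hu : Real.log y / ell D ^ 9 < 0.5
  · rw [if_pos hu, mul_one]
    obtain ⟨h1, h2⟩ := SmoothedStep.one_sub_step_bounds hΛ hK hy (z := 0.5) hu.le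
    have e : 0.004 * g₀ - I - (0.004 - T) = -(I - T) - 0.004 * (1 - g₀) := by ring
    rw [e]
    calc |-(I - T) - 0.004 * (1 - g₀)| ≤ |-(I - T)| + |0.004 * (1 - g₀)| := abs_sub _ _
      _ = |I - T| + 0.004 * (1 - g₀) := by
          rw [abs_neg, abs_of_nonneg (mul_nonneg (by norm_num) h1)]
      _ ≤ c + 0.004 * γ := by gcongr
  · rw [if_neg hu, mul_zero, zero_sub]
    have h2 := SmoothedStep.step_le_majorant hΛ hK hy (z := 0.5) (not_lt.mp hu)
    have h1 : 0 < g₀ := GaussWeight.gWeight_pos hΛ _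
    have e : 0.004 * g₀ - I - -T = -(I - T) + 0.004 * g₀ := by ring
    rw [e]
    calc |-(I - T) + 0.004 * g₀| ≤ |-(I - T)| + |0.004 * g₀| := abs_add_le _ _
      _ = |I - T| + 0.004 * g₀ := by rw [abs_neg, abs_of_pos (mul_pos (by norm_num) h1)]
      _ ≤ c + 0.004 * γ := by gcongr

/-- **Far form of the dual core estimate**: at distance `≥ δ ≥ 0` (in `u`) from both `0.496` and `0.5`
the kink term is `≤ 0.004·½e^{−𝓛³⁰(𝓛⁹δ)²}`. [cite: Zhang2022LandauSiegel, §12 p. 67, §11 p. 63, §4 (4.2)–(4.3)] -/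
private theorem core_profile_dual_far {D : ℕ} (hℓ : 0 < ell D) {y : ℝ} (hy : 0 < y) {δ : ℝ}
    (hδ : 0 ≤ δ) (h496 : δ ≤ |Real.log y / ell D ^ 9 - 0.496|)
    (h5 : δ ≤ |Real.log y / ell D ^ 9 - 0.5|) :
    |(0.004 * GaussWeight.gWeight (ell D ^ 30) (Real.exp (ell D ^ 9 * 0.5) / y) -
          ∫ z in (0.496 : ℝ)..0.5, GaussWeight.gWeight (ell D ^ 30) (Real.exp (ell D ^ 9 * z) / y)) -
        (0.004 * (if Real.log y / ell D ^ 9 < 0.5 then (1 : ℝ) else 0) -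
          (0.5 - max 0.496 (min (Real.log y / ell D ^ 9) 0.5)))| ≤
      0.004 * ((1 / 2) * Real.exp (-(ell D ^ 30) * (ell D ^ 9 * δ) ^ 2)) +
        0.004 * ((1 / 2) * Real.exp (-(ell D ^ 30) * (ell D ^ 9 * 0.5 - Real.log y) ^ 2)) := by
  have hΛ : 0 < ell D ^ 30 := pow_pos hℓ 30
  have hK : 0 < ell D ^ 9 := pow_pos hℓ 9
  set u : ℝ := Real.log y / ell D ^ 9 with hu_def
  set I : ℝ := ∫ z in (0.496 : ℝ)..0.5,
    GaussWeight.gWeight (ell D ^ 30) (Real.exp (ell D ^ 9 * z) / y) with hIdef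
  set g₀ : ℝ := GaussWeight.gWeight (ell D ^ 30) (Real.exp (ell D ^ 9 * 0.5) / y) with hg₀
  set E : ℝ := (1 / 2) * Real.exp (-(ell D ^ 30) * (ell D ^ 9 * δ) ^ 2) with hE
  set γ : ℝ := (1 / 2) * Real.exp (-(ell D ^ 30) * (ell D ^ 9 * 0.5 - Real.log y) ^ 2) with hγ
  set T : ℝ := 0.5 - max 0.496 (min u 0.5) with hT
  have hkink : |I - T| ≤ 0.004 * E := by
    rcases le_or_gt u (0.496 - δ) with hlo | hlo
    · have hcl : max 0.496 (min u 0.5) = 0.496 :=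
        max_eq_left (le_trans (min_le_left _ _) (by linarith))
      have h := SmoothedStep.integral_step_right_far hΛ hK hy hδ (a := 0.496) (b := 0.5)
        (by rw [← hu_def]; linarith) (by norm_num)
      rw [hT, hcl]
      have e : (0.5 : ℝ) - 0.496 = 0.004 := by norm_num
      rw [e] at h ⊢
      exact h
    · rcases lt_or_ge u (0.5 + δ) with hhi | hhi
      · have hu1 : 0.496 + δ ≤ u := by
          have : δ ≤ |u - 0.496| := h496
          rcases le_abs.mp this with h | h <;> [linarith; linarith]
        have hu2 : u ≤ 0.5 - δ := by
          have : δ ≤ |u - 0.5| := h5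
          rcases le_abs.mp this with h | h <;> [linarith; linarith]
        have hcl : max 0.496 (min u 0.5) = u := by
          rw [min_eq_left (by linarith), max_eq_right (by linarith)]
        have h := SmoothedStep.integral_step_middle hΛ hK hy hδ (a := 0.496) (b := 0.5)
          (by rw [← hu_def]; linarith) (by rw [← hu_def]; linarith)
        rw [hT, hcl]
        have e : (0.5 : ℝ) - 0.496 = 0.004 := by norm_num
        rw [e] at h
        rw [← hu_def] at h
        exact h
      · have hcl : max 0.496 (min u 0.5) = 0.5 := by
          rw [min_eq_right (by linarith), max_eq_right (by norm_num)]
        have h := SmoothedStep.integral_step_left_far hΛ hK hy hδ (a := 0.496) (b := 0.5)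
          (by norm_num) (by rw [← hu_def]; linarith)
        rw [hT, hcl, sub_self, sub_zero]
        have e : (0.5 : ℝ) - 0.496 = 0.004 := by norm_num
        rw [e] at h
        exact h
  by_cases hu : u < 0.5
  · rw [if_pos hu, mul_one]
    obtain ⟨h1, h2⟩ :=
      SmoothedStep.one_sub_step_bounds hΛ hK hy (z := 0.5) (by rw [← hu_def]; exact hu.le)
    have e : 0.004 * g₀ - I - (0.004 - T) = -(I - T) - 0.004 * (1 - g₀) := by ring
    rw [e]
    calc |-(I - T) - 0.004 * (1 - g₀)| ≤ |-(I - T)| + |0.004 * (1 - g₀)| := abs_sub _ _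
      _ = |I - T| + 0.004 * (1 - g₀) := by
          rw [abs_neg, abs_of_nonneg (mul_nonneg (by norm_num) h1)]
      _ ≤ 0.004 * E + 0.004 * γ := by gcongr
  · rw [if_neg hu, mul_zero, zero_sub]
    have h2 :=
      SmoothedStep.step_le_majorant hΛ hK hy (z := 0.5) (by rw [← hu_def]; exact not_lt.mp hu)
    have h1 : 0 < g₀ := GaussWeight.gWeight_pos hΛ _
    have e : 0.004 * g₀ - I - -T = -(I - T) + 0.004 * g₀ := by ring
    rw [e]
    calc |-(I - T) + 0.004 * g₀| ≤ |-(I - T)| + |0.004 * g₀| := abs_add_le _ _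
      _ = |I - T| + 0.004 * g₀ := by rw [abs_neg, abs_of_pos (mul_pos (by norm_num) h1)]
      _ ≤ 0.004 * E + 0.004 * γ := by gcongr

/-- `½√(π/(𝓛³⁰(𝓛⁹)²)) ≤ 𝓛⁻²⁴` (`𝓛 > 0`). [folklore] -/
private theorem half_sqrt_le' {D : ℕ} (hL : 0 < ell D) :
    (1 / 2) * Real.sqrt (π / (ell D ^ 30 * (ell D ^ 9) ^ 2)) ≤ (ell D ^ 24)⁻¹ := by
  have h48 : ell D ^ 30 * (ell D ^ 9) ^ 2 = (ell D ^ 24) ^ 2 := by ring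
  have hsq : Real.sqrt (π / (ell D ^ 30 * (ell D ^ 9) ^ 2)) ≤ 2 / ell D ^ 24 := by
    rw [h48]
    calc Real.sqrt (π / (ell D ^ 24) ^ 2) ≤ Real.sqrt ((2 / ell D ^ 24) ^ 2) := by
          apply Real.sqrt_le_sqrt
          rw [div_pow]
          exact div_le_div_of_nonneg_right (by nlinarith [Real.pi_lt_four]) (by positivity)
      _ = 2 / ell D ^ 24 := Real.sqrt_sq (by positivity)
  calc (1 / 2) * Real.sqrt (π / (ell D ^ 30 * (ell D ^ 9) ^ 2)) ≤ (1 / 2) * (2 / ell D ^ 24) := by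
        gcongr
    _ = (ell D ^ 24)⁻¹ := by ring

/-! ### The difference `I(n) − 0.504·(log(n/P″₁)/log P₁)𝟙[P″₁ < n < P″₂]` -/

section Profile

variable {D : ℕ}

/-- **Dual identity**: for `D ≥ 2`, `n ≥ 1`, `u = log(n/(Dt₀))/𝓛⁹`,
`I(n) − 0.504·(log(n/P″₁)/log P₁)𝟙[P″₁<n<P″₂] = (0.004g(P^{0.5}/Y) − ∫_{0.496}^{0.5}g(P^z/Y)dz) − (0.004𝟙[u<0.5] − (0.5 − clamp(u;0.496,0.5)))`
(`Y = n/(Dt₀)`). [cite: Zhang2022LandauSiegel, §12 p. 67 (tex L3427–L3447)] -/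
theorem dualInt_sub_sharp_eq (hD : 2 ≤ D) {n : ℕ} (hn : 1 ≤ n) :
    dualInt D n - 0.504 * (if P1pp D < (n : ℝ) ∧ (n : ℝ) < P2pp D then
        Real.log ((n : ℝ) / P1pp D) / Real.log (Skeleton.P1 D) else 0) =
      (0.004 * GaussWeight.gWeight (ell D ^ 30)
            (Real.exp (ell D ^ 9 * 0.5) / ((n : ℝ) / ((D : ℝ) * t0 D))) -
          ∫ z in (0.496 : ℝ)..0.5, GaussWeight.gWeight (ell D ^ 30)
            (Real.exp (ell D ^ 9 * z) / ((n : ℝ) / ((D : ℝ) * t0 D)))) -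
        (0.004 * (if Real.log ((n : ℝ) / ((D : ℝ) * t0 D)) / ell D ^ 9 < 0.5 then (1 : ℝ) else 0) -
          (0.5 - max 0.496 (min (Real.log ((n : ℝ) / ((D : ℝ) * t0 D)) / ell D ^ 9) 0.5))) := by
  have hℓ : 0 < ell D := ell_pos hD
  have hΛ : 0 < ell D ^ 30 := pow_pos hℓ 30
  have hK : 0 < ell D ^ 9 := pow_pos hℓ 9
  have hDt : 0 < (D : ℝ) * t0 D := D_mul_t0_pos' hD
  have hn0 : (0 : ℝ) < n := by exact_mod_cast hn
  have hy : 0 < (n : ℝ) / ((D : ℝ) * t0 D) := div_pos hn0 hDt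
  set y : ℝ := (n : ℝ) / ((D : ℝ) * t0 D) with hydef
  set u : ℝ := Real.log y / ell D ^ 9 with hu
  -- the smooth side
  have hmono : Monotone fun z : ℝ =>
      GaussWeight.gWeight (ell D ^ 30) (Real.exp (ell D ^ 9 * z) / y) :=
    SmoothedStep.step_monotone hΛ hK.le hy
  have hint : IntervalIntegrable
      (fun z : ℝ => GaussWeight.gWeight (ell D ^ 30) (Real.exp (ell D ^ 9 * z) / y))
      MeasureTheory.volume 0.496 0.5 := hmono.intervalIntegrable
  have hdual : dualInt D n = 0.004 * GaussWeight.gWeight (ell D ^ 30) (Real.exp (ell D ^ 9 * 0.5) / y) -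
      ∫ z in (0.496 : ℝ)..0.5, GaussWeight.gWeight (ell D ^ 30) (Real.exp (ell D ^ 9 * z) / y) := by
    rw [dualInt]
    simp only [gW_dual_arg hD]
    rw [← hydef, intervalIntegral.integral_sub intervalIntegrable_const hint,
      intervalIntegral.integral_const, smul_eq_mul]
    norm_num
  -- the sharp side
  have hsharp : 0.504 * (if P1pp D < (n : ℝ) ∧ (n : ℝ) < P2pp D then
        Real.log ((n : ℝ) / P1pp D) / Real.log (Skeleton.P1 D) else 0) =
      0.004 * (if u < 0.5 then (1 : ℝ) else 0) - (0.5 - max 0.496 (min u 0.5)) := by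
    have iff1 : P1pp D < (n : ℝ) ↔ 0.496 < u := by rw [hu, hydef]; exact P1pp_lt_iff hD hn
    have iff2 : (n : ℝ) < P2pp D ↔ u < 0.5 := by rw [hu, hydef]; exact lt_P2pp_iff hD hn
    by_cases hI : P1pp D < (n : ℝ) ∧ (n : ℝ) < P2pp D
    · have h2 : 0.496 < u := iff1.mp hI.1
      have h1 : u < 0.5 := iff2.mp hI.2
      have hlog : Real.log ((n : ℝ) / P1pp D) / Real.log (Skeleton.P1 D) = (u - 0.496) / 0.504 := by
        rw [log_div_P1pp_div hD hn, ← hydef, ← hu]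
      rw [if_pos hI, if_pos h1, hlog, min_eq_left h1.le, max_eq_right h2.le]
      ring
    · rw [if_neg hI]
      by_cases h1 : u < 0.5
      · have h2 : ¬ 0.496 < u := fun h => hI ⟨iff1.mpr h, iff2.mpr h1⟩
        rw [if_pos h1, max_eq_left (le_trans (min_le_left _ _) (not_lt.mp h2))]
        norm_num
      · rw [if_neg h1, min_eq_right (not_lt.mp h1), max_eq_right (by norm_num)]
        norm_num
  rw [hdual, hsharp]

/-- **Dual sharp profile (exact constants)**: for `D ≥ 2`, `n ≥ 1`,
`|I(n) − 0.504·(log(n/P″₁)/log P₁)𝟙[P″₁<n<P″₂]| ≤ ½√(π/(𝓛³⁰(𝓛⁹)²)) + 0.002·e^{−𝓛³⁰(𝓛⁹·0.5 − log(n/(Dt₀)))²}`.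
[cite: Zhang2022LandauSiegel, §12 p. 67] -/
theorem abs_dualInt_sub_sharp_le' (hD : 2 ≤ D) {n : ℕ} (hn : 1 ≤ n) :
    |dualInt D n - 0.504 * (if P1pp D < (n : ℝ) ∧ (n : ℝ) < P2pp D then
        Real.log ((n : ℝ) / P1pp D) / Real.log (Skeleton.P1 D) else 0)| ≤
      (1 / 2) * Real.sqrt (π / (ell D ^ 30 * (ell D ^ 9) ^ 2)) +
        0.002 * Real.exp (-(ell D ^ 30) *
          (ell D ^ 9 * 0.5 - Real.log ((n : ℝ) / ((D : ℝ) * t0 D))) ^ 2) := by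
  have hℓ : 0 < ell D := ell_pos hD
  have hy : 0 < (n : ℝ) / ((D : ℝ) * t0 D) :=
    div_pos (by exact_mod_cast hn) (D_mul_t0_pos' hD)
  rw [dualInt_sub_sharp_eq hD hn]
  have h := core_profile_dual (D := D) hℓ hy
  calc _ ≤ (1 / 2) * Real.sqrt (π / (ell D ^ 30 * (ell D ^ 9) ^ 2)) +
        0.004 * ((1 / 2) * Real.exp (-(ell D ^ 30) *
          (ell D ^ 9 * 0.5 - Real.log ((n : ℝ) / ((D : ℝ) * t0 D))) ^ 2)) := h
    _ = _ := by ring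

/-- **Dual sharp profile**: for `D ≥ 2`, `n ≥ 1`,
`|I(n) − 0.504·(log(n/P″₁)/log P₁)𝟙[P″₁<n<P″₂]| ≤ 𝓛⁻²⁴ + 0.002·e^{−𝓛³⁰(log(n/(Dt₀)) − 𝓛⁹/2)²}` — a
Gaussian of log-width `𝓛⁻¹⁵` around `P″₂ = P^{0.5}Dt₀` (height `0.002`) plus the uniform kink error.
[cite: Zhang2022LandauSiegel, §12 p. 67] -/
theorem abs_dualInt_sub_sharp_le (hD : 2 ≤ D) {n : ℕ} (hn : 1 ≤ n) :
    |dualInt D n - 0.504 * (if P1pp D < (n : ℝ) ∧ (n : ℝ) < P2pp D then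
        Real.log ((n : ℝ) / P1pp D) / Real.log (Skeleton.P1 D) else 0)| ≤
      (ell D ^ 24)⁻¹ +
        0.002 * Real.exp (-(ell D ^ 30) *
          (Real.log ((n : ℝ) / ((D : ℝ) * t0 D)) - ell D ^ 9 / 2) ^ 2) := by
  have hℓ : 0 < ell D := ell_pos hD
  have h := abs_dualInt_sub_sharp_le' hD hn
  have hc := half_sqrt_le' hℓ
  have e : (ell D ^ 9 * 0.5 - Real.log ((n : ℝ) / ((D : ℝ) * t0 D))) ^ 2 =
      (Real.log ((n : ℝ) / ((D : ℝ) * t0 D)) - ell D ^ 9 / 2) ^ 2 := by ring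
  rw [e] at h
  linarith

/-- **Dual sharp profile, far form**: for `D ≥ 2`, `n ≥ 1`, `0 ≤ w ≤ |log(n/(Dt₀)) − 𝓛⁹/2|` and
`w ≤ |log(n/(Dt₀)) − 0.496𝓛⁹|`: the difference is `≤ 0.004·e^{−𝓛³⁰w²}`.
[cite: Zhang2022LandauSiegel, §12 p. 67] -/
theorem abs_dualInt_sub_sharp_le_far (hD : 2 ≤ D) {n : ℕ} (hn : 1 ≤ n) {w : ℝ} (hw : 0 ≤ w)
    (h1 : w ≤ |Real.log ((n : ℝ) / ((D : ℝ) * t0 D)) - ell D ^ 9 / 2|)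
    (h2 : w ≤ |Real.log ((n : ℝ) / ((D : ℝ) * t0 D)) - 0.496 * ell D ^ 9|) :
    |dualInt D n - 0.504 * (if P1pp D < (n : ℝ) ∧ (n : ℝ) < P2pp D then
        Real.log ((n : ℝ) / P1pp D) / Real.log (Skeleton.P1 D) else 0)| ≤
      0.004 * Real.exp (-(ell D ^ 30) * w ^ 2) := by
  have hℓ : 0 < ell D := ell_pos hD
  have hK : 0 < ell D ^ 9 := pow_pos hℓ 9
  have hy : 0 < (n : ℝ) / ((D : ℝ) * t0 D) :=
    div_pos (by exact_mod_cast hn) (D_mul_t0_pos' hD)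
  set L : ℝ := Real.log ((n : ℝ) / ((D : ℝ) * t0 D)) with hL
  set δ : ℝ := w / ell D ^ 9 with hδ
  have hδ0 : 0 ≤ δ := div_nonneg hw hK.le
  have hKδ : ell D ^ 9 * δ = w := by rw [hδ]; field_simp
  have h5 : δ ≤ |L / ell D ^ 9 - 0.5| := by
    have e : L / ell D ^ 9 - 0.5 = (L - ell D ^ 9 / 2) / ell D ^ 9 := by
      field_simp; ring
    rw [e, abs_div, abs_of_pos hK, hδ]
    exact div_le_div_of_nonneg_right h1 hK.le
  have h496 : δ ≤ |L / ell D ^ 9 - 0.496| := by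
    have e : L / ell D ^ 9 - 0.496 = (L - 0.496 * ell D ^ 9) / ell D ^ 9 := by
      field_simp
    rw [e, abs_div, abs_of_pos hK, hδ]
    exact div_le_div_of_nonneg_right h2 hK.le
  rw [dualInt_sub_sharp_eq hD hn]
  have h := core_profile_dual_far (D := D) hℓ hy hδ0 h496 h5
  rw [hKδ] at h
  have hgauss : Real.exp (-(ell D ^ 30) * (ell D ^ 9 * 0.5 - L) ^ 2) ≤
      Real.exp (-(ell D ^ 30) * w ^ 2) := by
    apply Real.exp_le_exp.mpr
    have hsq : w ^ 2 ≤ (ell D ^ 9 * 0.5 - L) ^ 2 := by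
      have e : (ell D ^ 9 * 0.5 - L) ^ 2 = |L - ell D ^ 9 / 2| ^ 2 := by rw [sq_abs]; ring
      rw [e]
      exact pow_le_pow_left₀ hw h1 2
    have hΛ : 0 ≤ ell D ^ 30 := by positivity
    nlinarith
  have hE : 0 ≤ Real.exp (-(ell D ^ 30) * w ^ 2) := (Real.exp_pos _).le
  calc _ ≤ 0.004 * ((1 / 2) * Real.exp (-(ell D ^ 30) * w ^ 2)) +
        0.004 * ((1 / 2) * Real.exp (-(ell D ^ 30) * (ell D ^ 9 * 0.5 - L) ^ 2)) := h
    _ ≤ 0.004 * ((1 / 2) * Real.exp (-(ell D ^ 30) * w ^ 2)) +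
        0.004 * ((1 / 2) * Real.exp (-(ell D ^ 30) * w ^ 2)) := by gcongr
    _ = 0.004 * Real.exp (-(ell D ^ 30) * w ^ 2) := by ring

end Profile

/-! ### The literal `hS`-sequence of `eq128_of_sj_small` -/

section Literal

variable {D : ℕ} (χ : DirichletCharacter ℂ D)

/-- **The (12.8) dual coefficient sequence is `χ(n)(n/P″₁)^{β₆}·(I(n) − 0.504·(log(n/P″₁)/log P₁)𝟙[P″₁<n<P″₂])/0.504`
on the window `P″₁η₋ < n < P″₂η₊` and `0` off it**: the literal second `S_j`-argument of the hypothesis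
`hS` of `eq128_of_sj_small` (its first argument is the `conj` of this), `D ≥ 2`.
[cite: Zhang2022LandauSiegel, §12 (12.8) p. 67] -/
theorem c128_eq (hD : 2 ≤ D) (n : ℕ) :
    ((if n ∈ ((Finset.Ico 1 ⌈P2pp D * etaPM D 1⌉₊).filter
          (fun n : ℕ => P1pp D * etaPM D (-1) < n ∧ (n : ℝ) < P2pp D * etaPM D 1)) then
          χ (n : ZMod D) * (((n : ℝ) / P1pp D : ℝ) : ℂ) ^ beta6 D * ((dualInt D n / 0.504 : ℝ) : ℂ)
        else 0) -
        (if n ∈ ((Finset.Ico 1 ⌈P2pp D⌉₊).filter (fun n : ℕ => P1pp D < n ∧ (n : ℝ) < P2pp D)) then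
          χ (n : ZMod D) * (((n : ℝ) / P1pp D : ℝ) : ℂ) ^ beta6 D *
            ((Real.log ((n : ℝ) / P1pp D) / Real.log (Skeleton.P1 D) : ℝ) : ℂ)
        else 0)) =
      if P1pp D * etaPM D (-1) < n ∧ (n : ℝ) < P2pp D * etaPM D 1 then
        χ (n : ZMod D) * (((n : ℝ) / P1pp D : ℝ) : ℂ) ^ beta6 D *
          (((dualInt D n - 0.504 * (if P1pp D < (n : ℝ) ∧ (n : ℝ) < P2pp D then
              Real.log ((n : ℝ) / P1pp D) / Real.log (Skeleton.P1 D) else 0)) / 0.504 : ℝ) : ℂ)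
      else 0 := by
  have hℓ : 0 < ell D := ell_pos hD
  have hP0 : 0 < bigP D := Real.exp_pos _
  have hDt : 0 < (D : ℝ) * t0 D := D_mul_t0_pos' hD
  have hP1pp : 0 < P1pp D := by
    rw [P1pp, mul_assoc]; exact mul_pos (Real.rpow_pos_of_pos hP0 _) hDt
  have hP2pp : 0 < P2pp D := by
    rw [P2pp, mul_assoc]; exact mul_pos (Real.rpow_pos_of_pos hP0 _) hDt
  have hηm : etaPM D (-1) < 1 := by
    rw [etaPM, neg_one_mul]
    have h10 : 0 < (ell D ^ 10)⁻¹ := inv_pos.mpr (pow_pos hℓ 10)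
    exact Real.exp_lt_one_iff.mpr (by linarith)
  have hηp : 1 ≤ etaPM D 1 := by
    rw [etaPM, one_mul]; exact Real.one_le_exp (by positivity)
  simp only [Finset.mem_filter, Finset.mem_Ico]
  by_cases hW : P1pp D * etaPM D (-1) < n ∧ (n : ℝ) < P2pp D * etaPM D 1
  · rw [if_pos hW]
    obtain ⟨hW1, hW2⟩ := hW
    have hn0 : (0 : ℝ) < n := lt_trans (mul_pos hP1pp (Real.exp_pos _)) hW1
    have hn1 : 1 ≤ n := by exact_mod_cast Nat.one_le_iff_ne_zero.mpr (by
      rintro rfl; simp at hn0)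
    have hB : (1 ≤ n ∧ n < ⌈P2pp D * etaPM D 1⌉₊) ∧
        (P1pp D * etaPM D (-1) < n ∧ (n : ℝ) < P2pp D * etaPM D 1) :=
      ⟨⟨hn1, Nat.lt_ceil.mpr hW2⟩, hW1, hW2⟩
    rw [if_pos hB]
    by_cases hI : P1pp D < (n : ℝ) ∧ (n : ℝ) < P2pp D
    · have hA : (1 ≤ n ∧ n < ⌈P2pp D⌉₊) ∧ (P1pp D < n ∧ (n : ℝ) < P2pp D) :=
        ⟨⟨hn1, Nat.lt_ceil.mpr hI.2⟩, hI⟩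
      rw [if_pos hA, if_pos hI]
      push_cast
      ring
    · have hA : ¬ ((1 ≤ n ∧ n < ⌈P2pp D⌉₊) ∧ (P1pp D < n ∧ (n : ℝ) < P2pp D)) :=
        fun h => hI h.2
      rw [if_neg hA, if_neg hI]
      push_cast
      ring
  · rw [if_neg hW]
    have hB : ¬ ((1 ≤ n ∧ n < ⌈P2pp D * etaPM D 1⌉₊) ∧
        (P1pp D * etaPM D (-1) < n ∧ (n : ℝ) < P2pp D * etaPM D 1)) := fun h => hW h.2
    rw [if_neg hB, zero_sub, neg_eq_zero]
    -- the inner window `P″₁ < n < P″₂` lies inside the outer one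
    have hA : ¬ ((1 ≤ n ∧ n < ⌈P2pp D⌉₊) ∧ (P1pp D < n ∧ (n : ℝ) < P2pp D)) := by
      rintro ⟨-, h1, h2⟩
      apply hW
      constructor
      · calc P1pp D * etaPM D (-1) < P1pp D * 1 := by gcongr
          _ = P1pp D := mul_one _
          _ < n := h1
      · calc (n : ℝ) < P2pp D := h2
          _ = P2pp D * 1 := (mul_one _).symm
          _ ≤ P2pp D * etaPM D 1 := by gcongr
    rw [if_neg hA]

/-- **Termwise: `‖𝐜 n‖ ≤ (1/0.504)·|I(n) − 0.504·(log(n/P″₁)/log P₁)𝟙[P″₁<n<P″₂]|`** for the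
(12.8) dual sequence (`|χ| ≤ 1`, `|(n/P″₁)^{β₆}| = 1`), `D ≥ 2`. [cite: Zhang2022LandauSiegel, §12 (12.8) p. 67] -/
theorem norm_c128_le (hD : 2 ≤ D) (n : ℕ) :
    ‖(if n ∈ ((Finset.Ico 1 ⌈P2pp D * etaPM D 1⌉₊).filter
          (fun n : ℕ => P1pp D * etaPM D (-1) < n ∧ (n : ℝ) < P2pp D * etaPM D 1)) then
          χ (n : ZMod D) * (((n : ℝ) / P1pp D : ℝ) : ℂ) ^ beta6 D * ((dualInt D n / 0.504 : ℝ) : ℂ)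
        else 0) -
        (if n ∈ ((Finset.Ico 1 ⌈P2pp D⌉₊).filter (fun n : ℕ => P1pp D < n ∧ (n : ℝ) < P2pp D)) then
          χ (n : ZMod D) * (((n : ℝ) / P1pp D : ℝ) : ℂ) ^ beta6 D *
            ((Real.log ((n : ℝ) / P1pp D) / Real.log (Skeleton.P1 D) : ℝ) : ℂ)
        else 0)‖ ≤
      (1 / 0.504) * |dualInt D n - 0.504 * (if P1pp D < (n : ℝ) ∧ (n : ℝ) < P2pp D then
        Real.log ((n : ℝ) / P1pp D) / Real.log (Skeleton.P1 D) else 0)| := by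
  rw [c128_eq χ hD n]
  by_cases hW : P1pp D * etaPM D (-1) < n ∧ (n : ℝ) < P2pp D * etaPM D 1
  · have hP0 : 0 < bigP D := Real.exp_pos _
    have hP1pp : 0 < P1pp D := by
      rw [P1pp, mul_assoc]; exact mul_pos (Real.rpow_pos_of_pos hP0 _) (D_mul_t0_pos' hD)
    have hn0 : (0 : ℝ) < n := lt_trans (mul_pos hP1pp (Real.exp_pos _)) hW.1
    rw [if_pos hW, norm_mul, norm_mul, norm_cpow_beta6 (div_pos hn0 hP1pp), mul_one,
      Complex.norm_real, Real.norm_eq_abs, abs_div, abs_of_pos (by norm_num : (0 : ℝ) < 0.504)]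
    calc ‖χ (n : ZMod D)‖ * (_ / 0.504) ≤ 1 * (_ / 0.504) :=
          mul_le_mul_of_nonneg_right (DirichletCharacter.norm_le_one _ _) (by positivity)
      _ = _ := by ring
  · rw [if_neg hW, norm_zero]; positivity

/-- **The (12.8) dual sequence vanishes off the window `P″₁η₋ < n < P″₂η₊`** (`D ≥ 2`).
[cite: Zhang2022LandauSiegel, §12 (12.8) p. 67] -/
theorem c128_eq_zero_of_not_window (hD : 2 ≤ D) {n : ℕ}
    (hn : ¬ (P1pp D * etaPM D (-1) < n ∧ (n : ℝ) < P2pp D * etaPM D 1)) :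
    ((if n ∈ ((Finset.Ico 1 ⌈P2pp D * etaPM D 1⌉₊).filter
          (fun n : ℕ => P1pp D * etaPM D (-1) < n ∧ (n : ℝ) < P2pp D * etaPM D 1)) then
          χ (n : ZMod D) * (((n : ℝ) / P1pp D : ℝ) : ℂ) ^ beta6 D * ((dualInt D n / 0.504 : ℝ) : ℂ)
        else 0) -
        (if n ∈ ((Finset.Ico 1 ⌈P2pp D⌉₊).filter (fun n : ℕ => P1pp D < n ∧ (n : ℝ) < P2pp D)) then
          χ (n : ZMod D) * (((n : ℝ) / P1pp D : ℝ) : ℂ) ^ beta6 D *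
            ((Real.log ((n : ℝ) / P1pp D) / Real.log (Skeleton.P1 D) : ℝ) : ℂ)
        else 0)) = 0 := by
  rw [c128_eq χ hD n, if_neg hn]

/-- **Termwise sharp profile of the (12.8) dual coefficients**: for `D ≥ 2`, `n ≥ 1`,
`‖𝐜 n‖ ≤ 2·𝓛⁻²⁴ + 0.004·e^{−𝓛³⁰(log(n/(Dt₀)) − 𝓛⁹/2)²}` (Gaussian of log-width `𝓛⁻¹⁵` around `P″₂`).
[cite: Zhang2022LandauSiegel, §12 p. 67] -/
theorem norm_c128_le_profile (hD : 2 ≤ D) {n : ℕ} (hn : 1 ≤ n) :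
    ‖(if n ∈ ((Finset.Ico 1 ⌈P2pp D * etaPM D 1⌉₊).filter
          (fun n : ℕ => P1pp D * etaPM D (-1) < n ∧ (n : ℝ) < P2pp D * etaPM D 1)) then
          χ (n : ZMod D) * (((n : ℝ) / P1pp D : ℝ) : ℂ) ^ beta6 D * ((dualInt D n / 0.504 : ℝ) : ℂ)
        else 0) -
        (if n ∈ ((Finset.Ico 1 ⌈P2pp D⌉₊).filter (fun n : ℕ => P1pp D < n ∧ (n : ℝ) < P2pp D)) then
          χ (n : ZMod D) * (((n : ℝ) / P1pp D : ℝ) : ℂ) ^ beta6 D *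
            ((Real.log ((n : ℝ) / P1pp D) / Real.log (Skeleton.P1 D) : ℝ) : ℂ)
        else 0)‖ ≤
      2 * (ell D ^ 24)⁻¹ +
        0.004 * Real.exp (-(ell D ^ 30) *
          (Real.log ((n : ℝ) / ((D : ℝ) * t0 D)) - ell D ^ 9 / 2) ^ 2) := by
  have h := le_trans (norm_c128_le χ hD n)
    (mul_le_mul_of_nonneg_left (abs_dualInt_sub_sharp_le hD hn) (by norm_num))
  have hpos : 0 ≤ Real.exp (-(ell D ^ 30) *
      (Real.log ((n : ℝ) / ((D : ℝ) * t0 D)) - ell D ^ 9 / 2) ^ 2) := (Real.exp_pos _).le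
  have hinv : 0 ≤ (ell D ^ 24)⁻¹ := by
    have := ell_pos hD; positivity
  nlinarith

/-- **Termwise far bound of the (12.8) dual coefficients**: for `D ≥ 2`, `n ≥ 1`, `0 ≤ w`,
`w ≤ |log(n/(Dt₀)) − 𝓛⁹/2|`, `w ≤ |log(n/(Dt₀)) − 0.496𝓛⁹|`: `‖𝐜 n‖ ≤ 0.008·e^{−𝓛³⁰w²}`.
[cite: Zhang2022LandauSiegel, §12 p. 67] -/
theorem norm_c128_le_far (hD : 2 ≤ D) {n : ℕ} (hn : 1 ≤ n) {w : ℝ} (hw : 0 ≤ w)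
    (h1 : w ≤ |Real.log ((n : ℝ) / ((D : ℝ) * t0 D)) - ell D ^ 9 / 2|)
    (h2 : w ≤ |Real.log ((n : ℝ) / ((D : ℝ) * t0 D)) - 0.496 * ell D ^ 9|) :
    ‖(if n ∈ ((Finset.Ico 1 ⌈P2pp D * etaPM D 1⌉₊).filter
          (fun n : ℕ => P1pp D * etaPM D (-1) < n ∧ (n : ℝ) < P2pp D * etaPM D 1)) then
          χ (n : ZMod D) * (((n : ℝ) / P1pp D : ℝ) : ℂ) ^ beta6 D * ((dualInt D n / 0.504 : ℝ) : ℂ)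
        else 0) -
        (if n ∈ ((Finset.Ico 1 ⌈P2pp D⌉₊).filter (fun n : ℕ => P1pp D < n ∧ (n : ℝ) < P2pp D)) then
          χ (n : ZMod D) * (((n : ℝ) / P1pp D : ℝ) : ℂ) ^ beta6 D *
            ((Real.log ((n : ℝ) / P1pp D) / Real.log (Skeleton.P1 D) : ℝ) : ℂ)
        else 0)‖ ≤
      0.008 * Real.exp (-(ell D ^ 30) * w ^ 2) := by
  have h := le_trans (norm_c128_le χ hD n)
    (mul_le_mul_of_nonneg_left (abs_dualInt_sub_sharp_le_far hD hn hw h1 h2) (by norm_num))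
  have hE : 0 ≤ Real.exp (-(ell D ^ 30) * w ^ 2) := (Real.exp_pos _).le
  nlinarith

/-- **Termwise one-sided bound of the (12.8) dual coefficients** (away from `P″₂` only): for
`D ≥ 2`, `n ≥ 1`, `0 ≤ w ≤ |log(n/(Dt₀)) − 𝓛⁹/2|`: `‖𝐜 n‖ ≤ 2·𝓛⁻²⁴ + 0.004·e^{−𝓛³⁰w²}`.
[cite: Zhang2022LandauSiegel, §12 p. 67] -/
theorem norm_c128_le_of_far_half (hD : 2 ≤ D) {n : ℕ} (hn : 1 ≤ n) {w : ℝ} (hw : 0 ≤ w)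
    (h1 : w ≤ |Real.log ((n : ℝ) / ((D : ℝ) * t0 D)) - ell D ^ 9 / 2|) :
    ‖(if n ∈ ((Finset.Ico 1 ⌈P2pp D * etaPM D 1⌉₊).filter
          (fun n : ℕ => P1pp D * etaPM D (-1) < n ∧ (n : ℝ) < P2pp D * etaPM D 1)) then
          χ (n : ZMod D) * (((n : ℝ) / P1pp D : ℝ) : ℂ) ^ beta6 D * ((dualInt D n / 0.504 : ℝ) : ℂ)
        else 0) -
        (if n ∈ ((Finset.Ico 1 ⌈P2pp D⌉₊).filter (fun n : ℕ => P1pp D < n ∧ (n : ℝ) < P2pp D)) then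
          χ (n : ZMod D) * (((n : ℝ) / P1pp D : ℝ) : ℂ) ^ beta6 D *
            ((Real.log ((n : ℝ) / P1pp D) / Real.log (Skeleton.P1 D) : ℝ) : ℂ)
        else 0)‖ ≤
      2 * (ell D ^ 24)⁻¹ + 0.004 * Real.exp (-(ell D ^ 30) * w ^ 2) := by
  have h := norm_c128_le_profile χ hD hn
  have hgauss : Real.exp (-(ell D ^ 30) *
      (Real.log ((n : ℝ) / ((D : ℝ) * t0 D)) - ell D ^ 9 / 2) ^ 2) ≤
        Real.exp (-(ell D ^ 30) * w ^ 2) := by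
    apply Real.exp_le_exp.mpr
    have hsq : w ^ 2 ≤ (Real.log ((n : ℝ) / ((D : ℝ) * t0 D)) - ell D ^ 9 / 2) ^ 2 := by
      rw [← sq_abs (Real.log _ - _)]
      exact pow_le_pow_left₀ hw h1 2
    have hΛ : 0 ≤ ell D ^ 30 := by have := ell_pos hD; positivity
    nlinarith
  linarith

/-- **Termwise global bound of the (12.8) dual coefficients**: `‖𝐜 n‖ ≤ 0.005` for all `n`
(`D ≥ 2`, `𝓛 ≥ 2`). [cite: Zhang2022LandauSiegel, §12 p. 67] -/
theorem norm_c128_le_global (hD : 2 ≤ D) (hL : 2 ≤ ell D) (n : ℕ) :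
    ‖(if n ∈ ((Finset.Ico 1 ⌈P2pp D * etaPM D 1⌉₊).filter
          (fun n : ℕ => P1pp D * etaPM D (-1) < n ∧ (n : ℝ) < P2pp D * etaPM D 1)) then
          χ (n : ZMod D) * (((n : ℝ) / P1pp D : ℝ) : ℂ) ^ beta6 D * ((dualInt D n / 0.504 : ℝ) : ℂ)
        else 0) -
        (if n ∈ ((Finset.Ico 1 ⌈P2pp D⌉₊).filter (fun n : ℕ => P1pp D < n ∧ (n : ℝ) < P2pp D)) then
          χ (n : ZMod D) * (((n : ℝ) / P1pp D : ℝ) : ℂ) ^ beta6 D *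
            ((Real.log ((n : ℝ) / P1pp D) / Real.log (Skeleton.P1 D) : ℝ) : ℂ)
        else 0)‖ ≤ 0.005 := by
  rcases Nat.eq_zero_or_pos n with rfl | hn
  · rw [c128_eq_zero_of_not_window χ hD, norm_zero]
    · norm_num
    · rintro ⟨h, -⟩
      have hP0 : 0 < bigP D := Real.exp_pos _
      have hP1pp : 0 < P1pp D := by
        rw [P1pp, mul_assoc]; exact mul_pos (Real.rpow_pos_of_pos hP0 _) (D_mul_t0_pos' hD)
      have h0 : (0 : ℝ) < P1pp D * etaPM D (-1) := mul_pos hP1pp (Real.exp_pos _)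
      have : ((0 : ℕ) : ℝ) = 0 := Nat.cast_zero
      linarith
  · have h := norm_c128_le_profile χ hD hn
    have hexp : Real.exp (-(ell D ^ 30) *
        (Real.log ((n : ℝ) / ((D : ℝ) * t0 D)) - ell D ^ 9 / 2) ^ 2) ≤ 1 := by
      rw [Real.exp_le_one_iff]
      have : 0 ≤ ell D ^ 30 * (Real.log ((n : ℝ) / ((D : ℝ) * t0 D)) - ell D ^ 9 / 2) ^ 2 := by
        have := ell_pos hD; positivity
      linarith
    have hpow : (2 : ℝ) ^ 24 ≤ ell D ^ 24 := pow_le_pow_left₀ (by norm_num) hL 24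
    have hinv : (ell D ^ 24)⁻¹ ≤ ((2 : ℝ) ^ 24)⁻¹ := inv_anti₀ (by positivity) hpow
    have h24 : ((2 : ℝ) ^ 24)⁻¹ ≤ 0.0005 := by norm_num
    linarith

/-- The first `S_j`-argument of `eq128_of_sj_small` is `conj ∘ 𝐜`; its terms have the same norms
(§12 p. 67: the reflected side of (12.8)). [cite: Zhang2022LandauSiegel, §12 (12.8) p. 67] -/
theorem norm_conj_c128 (n : ℕ) :
    ‖conj ((if n ∈ ((Finset.Ico 1 ⌈P2pp D * etaPM D 1⌉₊).filter
          (fun n : ℕ => P1pp D * etaPM D (-1) < n ∧ (n : ℝ) < P2pp D * etaPM D 1)) then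
          χ (n : ZMod D) * (((n : ℝ) / P1pp D : ℝ) : ℂ) ^ beta6 D * ((dualInt D n / 0.504 : ℝ) : ℂ)
        else 0) -
        (if n ∈ ((Finset.Ico 1 ⌈P2pp D⌉₊).filter (fun n : ℕ => P1pp D < n ∧ (n : ℝ) < P2pp D)) then
          χ (n : ZMod D) * (((n : ℝ) / P1pp D : ℝ) : ℂ) ^ beta6 D *
            ((Real.log ((n : ℝ) / P1pp D) / Real.log (Skeleton.P1 D) : ℝ) : ℂ)
        else 0))‖ =
      ‖(if n ∈ ((Finset.Ico 1 ⌈P2pp D * etaPM D 1⌉₊).filter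
          (fun n : ℕ => P1pp D * etaPM D (-1) < n ∧ (n : ℝ) < P2pp D * etaPM D 1)) then
          χ (n : ZMod D) * (((n : ℝ) / P1pp D : ℝ) : ℂ) ^ beta6 D * ((dualInt D n / 0.504 : ℝ) : ℂ)
        else 0) -
        (if n ∈ ((Finset.Ico 1 ⌈P2pp D⌉₊).filter (fun n : ℕ => P1pp D < n ∧ (n : ℝ) < P2pp D)) then
          χ (n : ZMod D) * (((n : ℝ) / P1pp D : ℝ) : ℂ) ^ beta6 D *
            ((Real.log ((n : ℝ) / P1pp D) / Real.log (Skeleton.P1 D) : ℝ) : ℂ)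
        else 0)‖ :=
  Complex.norm_conj _

end Literal

end Literature.NumberTheory.LFunctions.Zhang2022.Typed.Sec12A
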